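import Literature.Probability.RandomPlanarGeometry.SAWLoopErasureMemoryTwoThreshold
import Literature.Probability.RandomPlanarGeometry.SAWLoopErasureMemoryTwoSeries
import Literature.Probability.RandomPlanarGeometry.SAWLoopErasureNbwCriticalTwoPoint
import Literature.Probability.RandomPlanarGeometry.SAWLoopErasureMemoryTwoAxisSymmetry
import HarnessLib

/-!
# The (2̃,1) linear system of Hara–Slade–Sokal at `β = 1/(2d−1)` over SRW Green-function values (`d ≥ 3`)

Topic `Literature/Probability/RandomPlanarGeometry` (Hara–Slade–Sokal loop-erasure lane; row (2̃,1) of HSS93 Table 2).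
With the single taboo point `b = e_t` the identity (3.13) (`tabooGF_singleton_eq`) determines the memory-2 taboo
two-point function `T(x) = C^{e_t}₂(0,x;β)` from the `2d` numbers `T(e_t − e_g)`, `|g| = 1`; at the threshold
`β = 1/(2d−1)` the free two-point function is `ρ_d · G` (`nbwGen_threshold_eq`, `ρ_d = (2d−2)/(2d−1)`,
`G = I_{1,0}` the SRW Green function), and by the axis symmetries (`SAWLoopErasureMemoryTwoAxisSymmetry`) the `2d`
unknowns collapse to THREE — `T(0)`, `T(2e_t)`, `T(e_t+e_u)` (`u ⊥ t`) — and every Green value entering collapses to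
one of SEVEN: `G(0), G(e_t), G(2e_t), G(e_t+e_u), G(3e_t), G(2e_t+e_u), G(e_t+e_u+e_r)` (`t, u, r` pairwise ⊥).
This module writes (3.13) at the five sites `x = 0, 2e_t, e_t+e_u, −e_t, e_u` in exactly these terms:

* `tabooGF_singleton_pair_eq`, `tabooGF_singleton_zsmul_eq`, `penGF_singleton_srev_eq`, `penGF_singleton_perp_eq`
  — the class reductions at generating-function level; `tabooGF_nonneg`, `tabooGF_le_nbwGen`;
* `tabooGF_singleton_threshold_eq` — (3.13) at `β = 1/(2d−1)` with `C^∅₂ = ρ_d G`;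
  `sum_dir_tabooGF_mul_eq` — `Σ_g T(e_t−e_g)Φ(g) = T(0)Φ(t) + T(2e_t)Φ(−t) + T(e_t+e_u) Σ_{g⊥t} Φ(g)`;
* **`hss313_zero`, `hss313_two`, `hss313_pair`, `hss313_neg`, `hss313_perp`** — the five linear identities
  (HSS93 (3.13)/(3.14) for `y = 0`, `b = e_t`: the `3 × 3` system for `T(0), T(2e_t), T(e_t+e_u)` and the two
  read-outs `T(−e_t)`, `T(e_u)`), with all Green values in canonical form;
* **`hss318_straight`, `hss318_bent`** — (3.18): `(1−β²)·C̃^{e_t;e_s}₂ = T(0) − β T(e_s)` for the STRAIGHT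
  (`e_s = −e_t`) and BENT (`e_s = e_u`) geometries;
* **`le_connectiveConstant_of_penGF_le`** — `μ(ℤ^d) ≥ (2d−1)/W` as soon as `W` bounds the two penalised series
  `C̃^{e_t;−e_t}₂`, `C̃^{e_t;e_u}₂` at `β = 1/(2d−1)` for ONE `t` and ONE `u ⊥ t`
  (`hss_memoryTwo_series_div_le_connectiveConstant_of_classes` + the class reductions).

All statements are `d`-generic (`d ≥ 3`); the per-dimension certificates (`d = 4, 5, 6`) feed the certified Green
enclosures of `SAWLoopErasureGreenNeighbourhood{Four,Five,Six}` into these identities.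

References: [HSS93] T. Hara, G. Slade, A. D. Sokal, J. Stat. Phys. 72 (1993) 479–517, arXiv:hep-lat/9302003,
§3.2 eq. (3.13)–(3.14) p. 18, §3.3 eq. (3.18) p. 19, §2.4 eq. (2.36)–(2.39) pp. 10–11, §4.1 p. 26, Table 2 p. 12.
-/

noncomputable section

namespace Literature.Probability.RandomPlanarGeometry.SAW.Zd.LoopErasure

open Finset Filter Topology
open scoped BigOperators
open Literature.Probability.LatticeModels Literature.Probability.LatticeModels.SRW
open Literature.Probability.Percolation (IsNBW srev srev_srev srev_ne_self)
open Literature.Probability.FitznerVanDerHofstad2017 (nbwCountR nbwCountR_nonneg nbwGen nbwGen_nonneg nbwRho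
  nbwRho_def srwI signedPermInvariant_srwI)

variable {d : ℕ}

/-! ### §1 Class reductions at generating-function level; positivity -/

/-- `C^{e_t}₂(0, a e_t + b e_s; β)` depends only on `(a,b)` for `s ⊥ t` (axis symmetry).
[cite: HaraSladeSokal1993, §3.2 p. 18 ("three inequivalent values of b+f, namely 0, 2e₁, and e₁+e₂")] -/
theorem tabooGF_singleton_pair_eq {t s t' s' : Dir d} (h : t.1 ≠ s.1) (h' : t'.1 ≠ s'.1) (a b : ℤ) (β : ℝ) :
    tabooGF {stepVec t} (a • stepVec t + b • stepVec s) β = tabooGF {stepVec t'} (a • stepVec t' + b • stepVec s') β :=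
  tsum_congr fun n => by rw [card_nbwAvoidTo_singleton_pair_eq h h']

/-- `C^{e_t}₂(0, a e_t; β)` does not depend on `t` (axis symmetry).
[cite: HaraSladeSokal1993, §3.2 p. 18 ("three inequivalent values of b+f, namely 0, 2e₁, and e₁+e₂")] -/
theorem tabooGF_singleton_zsmul_eq (t t' : Dir d) (a : ℤ) (β : ℝ) :
    tabooGF {stepVec t} (a • stepVec t) β = tabooGF {stepVec t'} (a • stepVec t') β :=
  tsum_congr fun n => by rw [card_nbwAvoidTo_singleton_zsmul_eq t t']

/-- The STRAIGHT penalised series `C̃^{e_t;−e_t}₂(0,0;β)` does not depend on `t`.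
[cite: HaraSladeSokal1993, §4.1 p. 26 ("by symmetry are the only two geometries to be considered")] -/
theorem penGF_singleton_srev_eq (t t' : Dir d) (β : ℝ) :
    penGF {stepVec t} (srev t) β = penGF {stepVec t'} (srev t') β :=
  tsum_congr fun n => by rw [card_closedNbwPen_singleton_srev_eq t t']

/-- The BENT penalised series `C̃^{e_t;e_s}₂(0,0;β)`, `s ⊥ t`, does not depend on `(t,s)`.
[cite: HaraSladeSokal1993, §4.1 p. 26 ("by symmetry are the only two geometries to be considered")] -/
theorem penGF_singleton_perp_eq {t s t' s' : Dir d} (h : t.1 ≠ s.1) (h' : t'.1 ≠ s'.1) (β : ℝ) :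
    penGF {stepVec t} s β = penGF {stepVec t'} s' β :=
  tsum_congr fun n => by rw [card_closedNbwPen_singleton_perp_eq h h']

/-- `0 ≤ C^A₂(0,x;β)` for `β ≥ 0`. [cite: HaraSladeSokal1993, §3.2 eq. (3.10) p. 17] -/
theorem tabooGF_nonneg (A : Finset (Site d)) (x : Site d) {β : ℝ} (hβ : 0 ≤ β) : 0 ≤ tabooGF A x β :=
  tsum_nonneg fun n => mul_nonneg (Nat.cast_nonneg _) (pow_nonneg hβ n)

/-- `C^A₂(0,x;β) ≤ C₂(0,x;β) = B_β(x)` for `0 ≤ β ≤ 1/(2d−1)` (`d ≥ 3`): fewer walks.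
[cite: HaraSladeSokal1993, §3.2 eq. (3.9)–(3.10) p. 17] -/
theorem tabooGF_le_nbwGen (hd : 3 ≤ d) (A : Finset (Site d)) (x : Site d) {β : ℝ} (hβ : 0 ≤ β)
    (hβc : β ≤ 1 / (2 * d - 1)) : tabooGF A x β ≤ nbwGen d β x := by
  rw [← tabooGF_empty_eq_nbwGen]
  refine (summable_card_nbwAvoidTo_mul_pow hd A x hβ hβc).tsum_le_tsum (fun n => ?_)
    (summable_card_nbwAvoidTo_mul_pow hd ∅ x hβ hβc)
  exact mul_le_mul_of_nonneg_right
    (by exact_mod_cast card_le_card (nbwAvoidTo_subset_of_subset (Finset.empty_subset A) x n)) (pow_nonneg hβ n)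

/-! ### §2 (3.13) at the threshold and the collapse of the `2d` unknowns to three -/

/-- The threshold parameter is non-negative: `0 ≤ 1/(2d−1)` (`d ≥ 1`).
[cite: HaraSladeSokal1993, §3.2 p. 17 (β = 1/(2d−1)); lane plumbing] -/
theorem memoryTwo_threshold_nonneg (d : ℕ) (hd : 1 ≤ d) : (0 : ℝ) ≤ 1 / (2 * d - 1) := by
  have : (1 : ℝ) ≤ d := by exact_mod_cast hd
  have : (0 : ℝ) < 2 * d - 1 := by linarith
  positivity

/-- **(3.13) with `b = e_t`, `A = ∅` at `β = 1/(2d−1)`**, where `C^∅₂ = ρ_d·G` (`nbwGen_threshold_eq`):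
`(1−β²)ρG(x) = (1−β²)T(x) + β Σ_g T(e_t−e_g)·(ρG(x−e_t) − βρG(x−e_t+e_g))`, `T = C^{e_t}₂(0,·;β)`, `G = I_{1,0}`.
[cite: HaraSladeSokal1993, §3.2 eq. (3.13) p. 18 with §2.1 eq. (2.13)–(2.14) p. 6] -/
theorem tabooGF_singleton_threshold_eq (hd : 3 ≤ d) (t : Dir d) (x : Site d) :
    (1 - (1 / (2 * (d : ℝ) - 1)) ^ 2) * (nbwRho d * srwI d 1 0 x) =
      (1 - (1 / (2 * (d : ℝ) - 1)) ^ 2) * tabooGF {stepVec t} x (1 / (2 * d - 1)) +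
        1 / (2 * (d : ℝ) - 1) * ∑ g : Dir d, tabooGF {stepVec t} (stepVec t - stepVec g) (1 / (2 * d - 1)) *
          (nbwRho d * srwI d 1 0 (x - stepVec t) -
            1 / (2 * (d : ℝ) - 1) * (nbwRho d * srwI d 1 0 (x - stepVec t + stepVec g))) := by
  have h := tabooGF_singleton_eq hd t x (memoryTwo_threshold_nonneg d (by omega)) le_rfl
  simpa only [nbwGen_threshold_eq hd] using h

/-- `e_t − e_{−t} = 2e_t`. [cite: HaraSladeSokal1993, §3.2 p. 18 ("three inequivalent values of b+f, namely 0, 2e₁, and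
e₁+e₂"); lane plumbing] -/
theorem stepVec_sub_stepVec_srev (t : Dir d) : stepVec t - stepVec (srev t) = (2 : ℤ) • stepVec t := by
  rw [stepVec_srev, sub_neg_eq_add, two_zsmul]

/-- For `g ⊥ t`: `T(e_t − e_g) = T(e_t + e_u)` (`u ⊥ t` fixed; axis symmetry).
[cite: HaraSladeSokal1993, §3.2 p. 18 ("three inequivalent values of b+f, namely 0, 2e₁, and e₁+e₂")] -/
theorem tabooGF_stepVec_sub_perp_eq {t u g : Dir d} (hut : u.1 ≠ t.1) (hgt : g.1 ≠ t.1) (β : ℝ) :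
    tabooGF {stepVec t} (stepVec t - stepVec g) β = tabooGF {stepVec t} (stepVec t + stepVec u) β := by
  have h1 : stepVec t - stepVec g = (1 : ℤ) • stepVec t + (1 : ℤ) • stepVec (srev g) := by
    rw [stepVec_srev, one_zsmul, one_zsmul, sub_eq_add_neg]
  have h2 : stepVec t + stepVec u = (1 : ℤ) • stepVec t + (1 : ℤ) • stepVec u := by rw [one_zsmul, one_zsmul]
  rw [h1, h2]
  exact tabooGF_singleton_pair_eq (s := srev g) (fun h => hgt h.symm) (fun h => hut h.symm) 1 1 β

/-- **Collapse of the `2d` unknowns**: for any weights `Φ`,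
`Σ_g T(e_t−e_g)Φ(g) = T(0)Φ(t) + T(2e_t)Φ(−t) + T(e_t+e_u)·Σ_{g⊥t}Φ(g)` (`u ⊥ t`).
[cite: HaraSladeSokal1993, §3.2 p. 18 ("three inequivalent values of b+f, namely 0, 2e₁, and e₁+e₂")] -/
theorem sum_dir_tabooGF_mul_eq {t u : Dir d} (hut : u.1 ≠ t.1) (β : ℝ) (Φ : Dir d → ℝ) :
    ∑ g : Dir d, tabooGF {stepVec t} (stepVec t - stepVec g) β * Φ g =
      tabooGF {stepVec t} 0 β * Φ t + tabooGF {stepVec t} ((2 : ℤ) • stepVec t) β * Φ (srev t) +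
        tabooGF {stepVec t} (stepVec t + stepVec u) β *
          ∑ g ∈ univ.filter (fun g : Dir d => g.1 ≠ t.1), Φ g := by
  rw [sum_dir_eq_add_add_sum_filter _ t, sub_self, stepVec_sub_stepVec_srev, mul_sum]
  congr 1
  refine sum_congr rfl fun g hg => ?_
  rw [tabooGF_stepVec_sub_perp_eq hut (mem_filter.1 hg).2]

/-! ### §3 Green values by class -/

/-- `G(a e_g) = G(a e_t)`. [cite: HaraSladeSokal1993, App. A.1 p. 27 (lattice symmetry of C₀)] -/
theorem srwI_zsmul_dir (g t : Dir d) (a : ℤ) : srwI d 1 0 (a • stepVec g) = srwI d 1 0 (a • stepVec t) :=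
  srwI_dir_eq g t a 1 0

/-- `G(e_g) = G(e_t)`. [cite: HaraSladeSokal1993, App. A.1 p. 27 (lattice symmetry of C₀)] -/
theorem srwI_stepVec_dir (g t : Dir d) : srwI d 1 0 (stepVec g) = srwI d 1 0 (stepVec t) := by
  simpa only [one_zsmul] using srwI_zsmul_dir g t 1

/-- `G(−x) = G(x)` for `x = a e_g`: `G(−a e_g) = G(a e_t)`. [cite: HaraSladeSokal1993, App. A.1 p. 27 (lattice symmetry of C₀)]
-/
theorem srwI_neg_zsmul_dir (g t : Dir d) (a : ℤ) : srwI d 1 0 (-(a • stepVec g)) = srwI d 1 0 (a • stepVec t) := by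
  rw [← smul_neg, ← stepVec_srev]
  exact srwI_zsmul_dir (srev g) t a

/-- `G(a e_g + b e_h) = G(a e_t + b e_u)` for `g ⊥ h`, `t ⊥ u`. [cite: HaraSladeSokal1993, App. A.1 p. 27 (lattice symmetry of
C₀)] -/
theorem srwI_pair_dir {g h t u : Dir d} (hgh : g.1 ≠ h.1) (htu : t.1 ≠ u.1) (a b : ℤ) :
    srwI d 1 0 (a • stepVec g + b • stepVec h) = srwI d 1 0 (a • stepVec t + b • stepVec u) :=
  srwI_dir_pair_eq hgh htu a b 1 0

/-- `G(a e_g + b e_h + c e_k) = G(a e_t + b e_u + c e_r)` for pairwise `⊥` triples.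
[cite: HaraSladeSokal1993, App. A.1 p. 27 (lattice symmetry of C₀)] -/
theorem srwI_triple_dir {g h k t u r : Dir d} (hgh : g.1 ≠ h.1) (hgk : g.1 ≠ k.1) (hhk : h.1 ≠ k.1)
    (htu : t.1 ≠ u.1) (htr : t.1 ≠ r.1) (hur : u.1 ≠ r.1) (a b c : ℤ) :
    srwI d 1 0 (a • stepVec g + b • stepVec h + c • stepVec k) =
      srwI d 1 0 (a • stepVec t + b • stepVec u + c • stepVec r) :=
  srwI_dir_triple_eq hgh hgk hhk htu htr hur a b c 1 0


/-- `Σ_{g⊥t} F(g) = (2d−2)·c` when `F ≡ c` on `g ⊥ t`. [cite: HaraSladeSokal1993, §3.2 eq. (3.14a) p. 18 (the coefficient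
2d−2)] -/
theorem sum_filter_perp_eq_mul (hd : 1 ≤ d) {t : Dir d} (F : Dir d → ℝ) (c : ℝ)
    (h : ∀ g : Dir d, g.1 ≠ t.1 → F g = c) :
    ∑ g ∈ univ.filter (fun g : Dir d => g.1 ≠ t.1), F g = (2 * (d : ℝ) - 2) * c := by
  rw [sum_congr rfl fun g hg => h g (mem_filter.1 hg).2, sum_const, card_univ_filter_dir_fst_ne, nsmul_eq_mul,
    Nat.cast_sub (by omega)]
  push_cast
  ring

/-- `Σ_{g⊥t} F(g) = F(u) + F(−u) + (2d−4)·c` when `F ≡ c` on `g ⊥ t, u` (`u ⊥ t`).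
[cite: HaraSladeSokal1993, §3.2 eq. (3.14c) p. 18 (the coefficient 2d−3 = 1 + (2d−4))] -/
theorem sum_filter_perp_eq_add_add_mul (hd : 2 ≤ d) {t u : Dir d} (hut : u.1 ≠ t.1) (F : Dir d → ℝ) (c : ℝ)
    (h : ∀ g : Dir d, g.1 ≠ t.1 → g.1 ≠ u.1 → F g = c) :
    ∑ g ∈ univ.filter (fun g : Dir d => g.1 ≠ t.1), F g = F u + F (srev u) + (2 * (d : ℝ) - 4) * c := by
  rw [sum_filter_fst_ne_eq F hut,
    sum_congr rfl fun g hg => h g (mem_filter.1 hg).2.1 (mem_filter.1 hg).2.2, sum_const,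
    card_univ_filter_dir_fst_ne_ne hut, nsmul_eq_mul, Nat.cast_sub (by omega)]
  push_cast
  ring

/-! ### §4 The five identities (3.13) at `x = 0, 2e_t, e_t+e_u, −e_t, e_u`

Notation of the docstrings: `β = 1/(2d−1)`, `ρ = ρ_d`, `T(x) = C^{e_t}₂(0,x;β)`, `G = I_{1,0}`,
`G₀ = G(0)`, `G₁ = G(e_t)`, `G₂ = G(2e_t)`, `G₁₁ = G(e_t+e_u)`, `G₃ = G(3e_t)`, `G₂₁ = G(2e_t+e_u)`,
`G₁₁₁ = G(e_t+e_u+e_r)` (`t,u,r` pairwise ⊥). -/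

/-- **(3.13) at `x = 0`**: `(1−β²)ρG₀ = (1−β²)T(0) + β[T(0)(ρG₁−βρG₀) + T(2e_t)(ρG₁−βρG₂) + T(e_t+e_u)(2d−2)(ρG₁−βρG₁₁)]`.
[cite: HaraSladeSokal1993, §3.2 eq. (3.13)–(3.14a) p. 18] -/
theorem hss313_zero (hd : 3 ≤ d) {t u : Dir d} (hut : u.1 ≠ t.1) :
    (1 - (1 / (2 * (d : ℝ) - 1)) ^ 2) * (nbwRho d * srwI d 1 0 0) =
      (1 - (1 / (2 * (d : ℝ) - 1)) ^ 2) * tabooGF {stepVec t} 0 (1 / (2 * d - 1)) +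
        1 / (2 * (d : ℝ) - 1) *
          (tabooGF {stepVec t} 0 (1 / (2 * d - 1)) *
              (nbwRho d * srwI d 1 0 (stepVec t) - 1 / (2 * (d : ℝ) - 1) * (nbwRho d * srwI d 1 0 0)) +
            tabooGF {stepVec t} ((2 : ℤ) • stepVec t) (1 / (2 * d - 1)) *
              (nbwRho d * srwI d 1 0 (stepVec t) -
                1 / (2 * (d : ℝ) - 1) * (nbwRho d * srwI d 1 0 ((2 : ℤ) • stepVec t))) +
            tabooGF {stepVec t} (stepVec t + stepVec u) (1 / (2 * d - 1)) *
              ((2 * (d : ℝ) - 2) * (nbwRho d * srwI d 1 0 (stepVec t) -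
                1 / (2 * (d : ℝ) - 1) * (nbwRho d * srwI d 1 0 (stepVec t + stepVec u))))) := by
  have h := tabooGF_singleton_threshold_eq hd t 0
  rw [sum_dir_tabooGF_mul_eq hut] at h
  have g1 : srwI d 1 0 ((0 : Site d) - stepVec t) = srwI d 1 0 (stepVec t) := by
    rw [zero_sub, ← stepVec_srev]; exact srwI_stepVec_dir (srev t) t
  have g0 : srwI d 1 0 ((0 : Site d) - stepVec t + stepVec t) = srwI d 1 0 0 := by rw [sub_add_cancel]
  have g2 : srwI d 1 0 ((0 : Site d) - stepVec t + stepVec (srev t)) = srwI d 1 0 ((2 : ℤ) • stepVec t) := by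
    rw [show (0 : Site d) - stepVec t + stepVec (srev t) = -((2 : ℤ) • stepVec t) by rw [stepVec_srev]; abel]
    exact srwI_neg_zsmul_dir t t 2
  have g11 : ∀ g : Dir d, g.1 ≠ t.1 →
      srwI d 1 0 ((0 : Site d) - stepVec t + stepVec g) = srwI d 1 0 (stepVec t + stepVec u) := by
    intro g hg
    rw [show (0 : Site d) - stepVec t + stepVec g = (1 : ℤ) • stepVec (srev t) + (1 : ℤ) • stepVec g by
      rw [stepVec_srev]; abel, srwI_pair_dir (g := srev t) (h := g) (t := t) (u := u) (fun e => hg e.symm)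
      (fun e => hut e.symm), one_zsmul, one_zsmul]
  rw [g1, g0, g2, sum_filter_perp_eq_mul (by omega) _
    (nbwRho d * srwI d 1 0 (stepVec t) - 1 / (2 * (d : ℝ) - 1) * (nbwRho d * srwI d 1 0 (stepVec t + stepVec u)))
    (fun g hg => by rw [g11 g hg])] at h
  exact h

/-- **(3.13) at `x = 2e_t`**: `(1−β²)ρG₂ = (1−β²)T(2e_t) + β[T(0)(ρG₁−βρG₂) + T(2e_t)(ρG₁−βρG₀) + T(e_t+e_u)(2d−2)(ρG₁−βρG₁₁)]`.
[cite: HaraSladeSokal1993, §3.2 eq. (3.13)–(3.14b) p. 18] -/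
theorem hss313_two (hd : 3 ≤ d) {t u : Dir d} (hut : u.1 ≠ t.1) :
    (1 - (1 / (2 * (d : ℝ) - 1)) ^ 2) * (nbwRho d * srwI d 1 0 ((2 : ℤ) • stepVec t)) =
      (1 - (1 / (2 * (d : ℝ) - 1)) ^ 2) * tabooGF {stepVec t} ((2 : ℤ) • stepVec t) (1 / (2 * d - 1)) +
        1 / (2 * (d : ℝ) - 1) *
          (tabooGF {stepVec t} 0 (1 / (2 * d - 1)) *
              (nbwRho d * srwI d 1 0 (stepVec t) -
                1 / (2 * (d : ℝ) - 1) * (nbwRho d * srwI d 1 0 ((2 : ℤ) • stepVec t))) +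
            tabooGF {stepVec t} ((2 : ℤ) • stepVec t) (1 / (2 * d - 1)) *
              (nbwRho d * srwI d 1 0 (stepVec t) - 1 / (2 * (d : ℝ) - 1) * (nbwRho d * srwI d 1 0 0)) +
            tabooGF {stepVec t} (stepVec t + stepVec u) (1 / (2 * d - 1)) *
              ((2 * (d : ℝ) - 2) * (nbwRho d * srwI d 1 0 (stepVec t) -
                1 / (2 * (d : ℝ) - 1) * (nbwRho d * srwI d 1 0 (stepVec t + stepVec u))))) := by
  have h := tabooGF_singleton_threshold_eq hd t ((2 : ℤ) • stepVec t)
  rw [sum_dir_tabooGF_mul_eq hut] at h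
  have e1 : (2 : ℤ) • stepVec t - stepVec t = stepVec t := by rw [two_zsmul, add_sub_cancel_right]
  have g2 : srwI d 1 0 (stepVec t + stepVec t) = srwI d 1 0 ((2 : ℤ) • stepVec t) := by rw [two_zsmul]
  have g0 : srwI d 1 0 (stepVec t + stepVec (srev t)) = srwI d 1 0 0 := by rw [stepVec_srev, add_neg_cancel]
  have g11 : ∀ g : Dir d, g.1 ≠ t.1 → srwI d 1 0 (stepVec t + stepVec g) = srwI d 1 0 (stepVec t + stepVec u) := by
    intro g hg
    rw [show stepVec t + stepVec g = (1 : ℤ) • stepVec t + (1 : ℤ) • stepVec g by rw [one_zsmul, one_zsmul],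
      srwI_pair_dir (g := t) (h := g) (t := t) (u := u) (fun e => hg e.symm) (fun e => hut e.symm), one_zsmul,
      one_zsmul]
  rw [e1, g2, g0, sum_filter_perp_eq_mul (by omega) _
    (nbwRho d * srwI d 1 0 (stepVec t) - 1 / (2 * (d : ℝ) - 1) * (nbwRho d * srwI d 1 0 (stepVec t + stepVec u)))
    (fun g hg => by rw [g11 g hg])] at h
  exact h

/-- **(3.13) at `x = e_t + e_u`** (`u ⊥ t`): `(1−β²)ρG₁₁ = (1−β²)T(e_t+e_u) + β[T(0)(ρG₁−βρG₁₁) + T(2e_t)(ρG₁−βρG₁₁)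
+ T(e_t+e_u)((ρG₁−βρG₂) + (ρG₁−βρG₀) + (2d−4)(ρG₁−βρG₁₁))]`. [cite: HaraSladeSokal1993, §3.2 eq. (3.13)–(3.14c) p. 18] -/
theorem hss313_pair (hd : 3 ≤ d) {t u : Dir d} (hut : u.1 ≠ t.1) :
    (1 - (1 / (2 * (d : ℝ) - 1)) ^ 2) * (nbwRho d * srwI d 1 0 (stepVec t + stepVec u)) =
      (1 - (1 / (2 * (d : ℝ) - 1)) ^ 2) * tabooGF {stepVec t} (stepVec t + stepVec u) (1 / (2 * d - 1)) +
        1 / (2 * (d : ℝ) - 1) *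
          (tabooGF {stepVec t} 0 (1 / (2 * d - 1)) *
              (nbwRho d * srwI d 1 0 (stepVec t) -
                1 / (2 * (d : ℝ) - 1) * (nbwRho d * srwI d 1 0 (stepVec t + stepVec u))) +
            tabooGF {stepVec t} ((2 : ℤ) • stepVec t) (1 / (2 * d - 1)) *
              (nbwRho d * srwI d 1 0 (stepVec t) -
                1 / (2 * (d : ℝ) - 1) * (nbwRho d * srwI d 1 0 (stepVec t + stepVec u))) +
            tabooGF {stepVec t} (stepVec t + stepVec u) (1 / (2 * d - 1)) *
              (nbwRho d * srwI d 1 0 (stepVec t) -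
                  1 / (2 * (d : ℝ) - 1) * (nbwRho d * srwI d 1 0 ((2 : ℤ) • stepVec t)) +
                (nbwRho d * srwI d 1 0 (stepVec t) - 1 / (2 * (d : ℝ) - 1) * (nbwRho d * srwI d 1 0 0)) +
                (2 * (d : ℝ) - 4) * (nbwRho d * srwI d 1 0 (stepVec t) -
                  1 / (2 * (d : ℝ) - 1) * (nbwRho d * srwI d 1 0 (stepVec t + stepVec u))))) := by
  have h := tabooGF_singleton_threshold_eq hd t (stepVec t + stepVec u)
  rw [sum_dir_tabooGF_mul_eq hut] at h
  have e1 : stepVec t + stepVec u - stepVec t = stepVec u := by rw [add_sub_cancel_left]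
  have g1 : srwI d 1 0 (stepVec u) = srwI d 1 0 (stepVec t) := srwI_stepVec_dir u t
  have gt : srwI d 1 0 (stepVec u + stepVec t) = srwI d 1 0 (stepVec t + stepVec u) := by rw [add_comm]
  have gs : srwI d 1 0 (stepVec u + stepVec (srev t)) = srwI d 1 0 (stepVec t + stepVec u) := by
    rw [show stepVec u + stepVec (srev t) = (1 : ℤ) • stepVec (srev t) + (1 : ℤ) • stepVec u by
      rw [one_zsmul, one_zsmul, add_comm], srwI_pair_dir (g := srev t) (h := u) (t := t) (u := u)
      (fun e => hut e.symm) (fun e => hut e.symm), one_zsmul, one_zsmul]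
  have gu : srwI d 1 0 (stepVec u + stepVec u) = srwI d 1 0 ((2 : ℤ) • stepVec t) := by
    rw [← two_zsmul]; exact srwI_zsmul_dir u t 2
  have gsu : srwI d 1 0 (stepVec u + stepVec (srev u)) = srwI d 1 0 0 := by rw [stepVec_srev, add_neg_cancel]
  have g11 : ∀ g : Dir d, g.1 ≠ t.1 → g.1 ≠ u.1 →
      srwI d 1 0 (stepVec u + stepVec g) = srwI d 1 0 (stepVec t + stepVec u) := by
    intro g hgt hgu
    rw [show stepVec u + stepVec g = (1 : ℤ) • stepVec u + (1 : ℤ) • stepVec g by rw [one_zsmul, one_zsmul],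
      srwI_pair_dir (g := u) (h := g) (t := t) (u := u) (fun e => hgu e.symm) (fun e => hut e.symm), one_zsmul,
      one_zsmul]
  rw [e1, g1, gt, gs, sum_filter_perp_eq_add_add_mul (by omega) hut _
    (nbwRho d * srwI d 1 0 (stepVec t) - 1 / (2 * (d : ℝ) - 1) * (nbwRho d * srwI d 1 0 (stepVec t + stepVec u)))
    (fun g hgt hgu => by rw [g11 g hgt hgu]), gu, gsu] at h
  exact h

/-- **(3.13) at `x = −e_t`** (the STRAIGHT read-out): `(1−β²)ρG₁ = (1−β²)T(−e_t) + β[T(0)(ρG₂−βρG₁) + T(2e_t)(ρG₂−βρG₃)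
+ T(e_t+e_u)(2d−2)(ρG₂−βρG₂₁)]`. [cite: HaraSladeSokal1993, §3.2 eq. (3.13) p. 18 and §3.3 eq. (3.18) p. 19] -/
theorem hss313_neg (hd : 3 ≤ d) {t u : Dir d} (hut : u.1 ≠ t.1) :
    (1 - (1 / (2 * (d : ℝ) - 1)) ^ 2) * (nbwRho d * srwI d 1 0 (stepVec t)) =
      (1 - (1 / (2 * (d : ℝ) - 1)) ^ 2) * tabooGF {stepVec t} (stepVec (srev t)) (1 / (2 * d - 1)) +
        1 / (2 * (d : ℝ) - 1) *
          (tabooGF {stepVec t} 0 (1 / (2 * d - 1)) *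
              (nbwRho d * srwI d 1 0 ((2 : ℤ) • stepVec t) -
                1 / (2 * (d : ℝ) - 1) * (nbwRho d * srwI d 1 0 (stepVec t))) +
            tabooGF {stepVec t} ((2 : ℤ) • stepVec t) (1 / (2 * d - 1)) *
              (nbwRho d * srwI d 1 0 ((2 : ℤ) • stepVec t) -
                1 / (2 * (d : ℝ) - 1) * (nbwRho d * srwI d 1 0 ((3 : ℤ) • stepVec t))) +
            tabooGF {stepVec t} (stepVec t + stepVec u) (1 / (2 * d - 1)) *
              ((2 * (d : ℝ) - 2) * (nbwRho d * srwI d 1 0 ((2 : ℤ) • stepVec t) -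
                1 / (2 * (d : ℝ) - 1) * (nbwRho d * srwI d 1 0 ((2 : ℤ) • stepVec t + stepVec u))))) := by
  have h := tabooGF_singleton_threshold_eq hd t (stepVec (srev t))
  rw [sum_dir_tabooGF_mul_eq hut] at h
  have gx : srwI d 1 0 (stepVec (srev t)) = srwI d 1 0 (stepVec t) := srwI_stepVec_dir (srev t) t
  have g2 : srwI d 1 0 (stepVec (srev t) - stepVec t) = srwI d 1 0 ((2 : ℤ) • stepVec t) := by
    rw [show stepVec (srev t) - stepVec t = -((2 : ℤ) • stepVec t) by rw [stepVec_srev]; abel]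
    exact srwI_neg_zsmul_dir t t 2
  have g1 : srwI d 1 0 (stepVec (srev t) - stepVec t + stepVec t) = srwI d 1 0 (stepVec t) := by
    rw [sub_add_cancel, gx]
  have g3 : srwI d 1 0 (stepVec (srev t) - stepVec t + stepVec (srev t)) = srwI d 1 0 ((3 : ℤ) • stepVec t) := by
    rw [show stepVec (srev t) - stepVec t + stepVec (srev t) = -((3 : ℤ) • stepVec t) by rw [stepVec_srev]; abel]
    exact srwI_neg_zsmul_dir t t 3
  have g21 : ∀ g : Dir d, g.1 ≠ t.1 →
      srwI d 1 0 (stepVec (srev t) - stepVec t + stepVec g) = srwI d 1 0 ((2 : ℤ) • stepVec t + stepVec u) := by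
    intro g hg
    rw [show stepVec (srev t) - stepVec t + stepVec g = (2 : ℤ) • stepVec (srev t) + (1 : ℤ) • stepVec g by
      rw [stepVec_srev]; abel, srwI_pair_dir (g := srev t) (h := g) (t := t) (u := u) (fun e => hg e.symm)
      (fun e => hut e.symm), one_zsmul]
  rw [gx, g2, g1, g3, sum_filter_perp_eq_mul (by omega) _
    (nbwRho d * srwI d 1 0 ((2 : ℤ) • stepVec t) -
      1 / (2 * (d : ℝ) - 1) * (nbwRho d * srwI d 1 0 ((2 : ℤ) • stepVec t + stepVec u)))
    (fun g hg => by rw [g21 g hg])] at h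
  exact h

/-- **(3.13) at `x = e_u`** (`u ⊥ t`, the BENT read-out): `(1−β²)ρG₁ = (1−β²)T(e_u) + β[T(0)(ρG₁₁−βρG₁)
+ T(2e_t)(ρG₁₁−βρG₂₁) + T(e_t+e_u)((ρG₁₁−βρG₂₁) + (ρG₁₁−βρG₁) + (2d−4)(ρG₁₁−βρG₁₁₁))]` (`r ⊥ t, u`).
[cite: HaraSladeSokal1993, §3.2 eq. (3.13) p. 18 and §3.3 eq. (3.18) p. 19] -/
theorem hss313_perp (hd : 3 ≤ d) {t u r : Dir d} (hut : u.1 ≠ t.1) (hrt : r.1 ≠ t.1) (hru : r.1 ≠ u.1) :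
    (1 - (1 / (2 * (d : ℝ) - 1)) ^ 2) * (nbwRho d * srwI d 1 0 (stepVec t)) =
      (1 - (1 / (2 * (d : ℝ) - 1)) ^ 2) * tabooGF {stepVec t} (stepVec u) (1 / (2 * d - 1)) +
        1 / (2 * (d : ℝ) - 1) *
          (tabooGF {stepVec t} 0 (1 / (2 * d - 1)) *
              (nbwRho d * srwI d 1 0 (stepVec t + stepVec u) -
                1 / (2 * (d : ℝ) - 1) * (nbwRho d * srwI d 1 0 (stepVec t))) +
            tabooGF {stepVec t} ((2 : ℤ) • stepVec t) (1 / (2 * d - 1)) *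
              (nbwRho d * srwI d 1 0 (stepVec t + stepVec u) -
                1 / (2 * (d : ℝ) - 1) * (nbwRho d * srwI d 1 0 ((2 : ℤ) • stepVec t + stepVec u))) +
            tabooGF {stepVec t} (stepVec t + stepVec u) (1 / (2 * d - 1)) *
              (nbwRho d * srwI d 1 0 (stepVec t + stepVec u) -
                  1 / (2 * (d : ℝ) - 1) * (nbwRho d * srwI d 1 0 ((2 : ℤ) • stepVec t + stepVec u)) +
                (nbwRho d * srwI d 1 0 (stepVec t + stepVec u) -
                  1 / (2 * (d : ℝ) - 1) * (nbwRho d * srwI d 1 0 (stepVec t))) +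
                (2 * (d : ℝ) - 4) * (nbwRho d * srwI d 1 0 (stepVec t + stepVec u) -
                  1 / (2 * (d : ℝ) - 1) * (nbwRho d * srwI d 1 0 (stepVec t + stepVec u + stepVec r))))) := by
  have h := tabooGF_singleton_threshold_eq hd t (stepVec u)
  rw [sum_dir_tabooGF_mul_eq hut] at h
  have gx : srwI d 1 0 (stepVec u) = srwI d 1 0 (stepVec t) := srwI_stepVec_dir u t
  have g11 : srwI d 1 0 (stepVec u - stepVec t) = srwI d 1 0 (stepVec t + stepVec u) := by
    rw [show stepVec u - stepVec t = (1 : ℤ) • stepVec (srev t) + (1 : ℤ) • stepVec u by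
      rw [stepVec_srev]; abel, srwI_pair_dir (g := srev t) (h := u) (t := t) (u := u) (fun e => hut e.symm)
      (fun e => hut e.symm), one_zsmul, one_zsmul]
  have g1 : srwI d 1 0 (stepVec u - stepVec t + stepVec t) = srwI d 1 0 (stepVec t) := by
    rw [sub_add_cancel, gx]
  have g21 : srwI d 1 0 (stepVec u - stepVec t + stepVec (srev t)) = srwI d 1 0 ((2 : ℤ) • stepVec t + stepVec u) := by
    rw [show stepVec u - stepVec t + stepVec (srev t) = (2 : ℤ) • stepVec (srev t) + (1 : ℤ) • stepVec u by
      rw [stepVec_srev]; abel, srwI_pair_dir (g := srev t) (h := u) (t := t) (u := u) (fun e => hut e.symm)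
      (fun e => hut e.symm), one_zsmul]
  have gu : srwI d 1 0 (stepVec u - stepVec t + stepVec u) = srwI d 1 0 ((2 : ℤ) • stepVec t + stepVec u) := by
    rw [show stepVec u - stepVec t + stepVec u = (2 : ℤ) • stepVec u + (1 : ℤ) • stepVec (srev t) by
      rw [stepVec_srev]; abel, srwI_pair_dir (g := u) (h := srev t) (t := t) (u := u) hut (fun e => hut e.symm),
      one_zsmul]
  have gsu : srwI d 1 0 (stepVec u - stepVec t + stepVec (srev u)) = srwI d 1 0 (stepVec t) := by
    rw [show stepVec u - stepVec t + stepVec (srev u) = stepVec (srev t) by rw [stepVec_srev, stepVec_srev]; abel]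
    exact srwI_stepVec_dir (srev t) t
  have g111 : ∀ g : Dir d, g.1 ≠ t.1 → g.1 ≠ u.1 →
      srwI d 1 0 (stepVec u - stepVec t + stepVec g) = srwI d 1 0 (stepVec t + stepVec u + stepVec r) := by
    intro g hgt hgu
    rw [show stepVec u - stepVec t + stepVec g =
        (1 : ℤ) • stepVec (srev t) + (1 : ℤ) • stepVec u + (1 : ℤ) • stepVec g by rw [stepVec_srev]; abel,
      srwI_triple_dir (g := srev t) (h := u) (k := g) (t := t) (u := u) (r := r)
      (fun e => hut e.symm) (fun e => hgt e.symm) (fun e => hgu e.symm) (fun e => hut e.symm) (fun e => hrt e.symm)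
      (fun e => hru e.symm), one_zsmul, one_zsmul, one_zsmul]
  rw [gx, g11, g1, g21, sum_filter_perp_eq_add_add_mul (by omega) hut _
    (nbwRho d * srwI d 1 0 (stepVec t + stepVec u) -
      1 / (2 * (d : ℝ) - 1) * (nbwRho d * srwI d 1 0 (stepVec t + stepVec u + stepVec r)))
    (fun g hgt hgu => by rw [g111 g hgt hgu]), gu, gsu] at h
  exact h

/-! ### §5 (3.18) for the two geometries and the (2̃,1) read-out `μ ≥ (2d−1)/W` -/

/-- **(3.18), STRAIGHT geometry** (`e_s = −e_t`): `(1−β²)·C̃^{e_t;−e_t}₂(0,0;β) = T(0) − β·T(−e_t)` at `β = 1/(2d−1)`.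
[cite: HaraSladeSokal1993, §3.3 eq. (3.18) p. 19; §4.1 p. 26 (straight geometry)] -/
theorem hss318_straight (hd : 3 ≤ d) (t : Dir d) :
    (1 - (1 / (2 * (d : ℝ) - 1)) ^ 2) * penGF {stepVec t} (srev t) (1 / (2 * d - 1)) =
      tabooGF {stepVec t} 0 (1 / (2 * d - 1)) -
        1 / (2 * (d : ℝ) - 1) * tabooGF {stepVec t} (stepVec (srev t)) (1 / (2 * d - 1)) :=
  penGF_singleton_eq hd (srev_ne_self t) (memoryTwo_threshold_nonneg d (by omega)) le_rfl

/-- **(3.18), BENT geometry** (`e_s = e_u`, `u ⊥ t`): `(1−β²)·C̃^{e_t;e_u}₂(0,0;β) = T(0) − β·T(e_u)` at `β = 1/(2d−1)`.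
[cite: HaraSladeSokal1993, §3.3 eq. (3.18) p. 19; §4.1 p. 26 (bent geometry)] -/
theorem hss318_bent (hd : 3 ≤ d) {t u : Dir d} (hut : u.1 ≠ t.1) :
    (1 - (1 / (2 * (d : ℝ) - 1)) ^ 2) * penGF {stepVec t} u (1 / (2 * d - 1)) =
      tabooGF {stepVec t} 0 (1 / (2 * d - 1)) -
        1 / (2 * (d : ℝ) - 1) * tabooGF {stepVec t} (stepVec u) (1 / (2 * d - 1)) :=
  penGF_singleton_eq hd (fun e => hut (congrArg Prod.fst e)) (memoryTwo_threshold_nonneg d (by omega)) le_rfl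

/-- **The (2̃,1) read-out.** If `W > 0` bounds the STRAIGHT and the BENT penalised series at `β = 1/(2d−1)` for one
direction `t` and one `u ⊥ t`, then `μ(ℤ^d) ≥ (2d−1)/W` (`d ≥ 3`): by the axis symmetries the two bounds hold for every
geometry, the partial sums of the coefficient series are bounded by the series (`sum_range_card_closedNbwPen_le_penGF`),
and `hss_memoryTwo_series_div_le_connectiveConstant_of_classes` applies.
[cite: HaraSladeSokal1993, §2.4 eq. (2.36)–(2.39) pp. 10–11; §4.1 p. 26; Table 2 p. 12 (row (2̃,1))] -/
theorem le_connectiveConstant_of_penGF_le (hd : 3 ≤ d) {t u : Dir d} (hut : u.1 ≠ t.1) {W : ℝ} (hW0 : 0 < W)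
    (hs : penGF {stepVec t} (srev t) (1 / (2 * d - 1)) ≤ W) (hb : penGF {stepVec t} u (1 / (2 * d - 1)) ≤ W) :
    (2 * (d : ℝ) - 1) / W ≤ connectiveConstant d := by
  have hβ := memoryTwo_threshold_nonneg d (by omega)
  refine hss_memoryTwo_series_div_le_connectiveConstant_of_classes hd hW0 (fun t' K => ?_) (fun t' s hs' K => ?_)
  · calc ∑ j ∈ range (K + 1), ((closedNbwPen {stepVec t'} (srev t') j).card : ℝ) * (1 / (2 * (d : ℝ) - 1)) ^ j
        ≤ penGF {stepVec t'} (srev t') (1 / (2 * d - 1)) :=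
          sum_range_card_closedNbwPen_le_penGF hd {stepVec t'} (srev t') hβ le_rfl (K + 1)
      _ = penGF {stepVec t} (srev t) (1 / (2 * d - 1)) := penGF_singleton_srev_eq t' t _
      _ ≤ W := hs
  · calc ∑ j ∈ range (K + 1), ((closedNbwPen {stepVec t'} s j).card : ℝ) * (1 / (2 * (d : ℝ) - 1)) ^ j
        ≤ penGF {stepVec t'} s (1 / (2 * d - 1)) :=
          sum_range_card_closedNbwPen_le_penGF hd {stepVec t'} s hβ le_rfl (K + 1)
      _ = penGF {stepVec t} u (1 / (2 * d - 1)) := penGF_singleton_perp_eq (fun e => hs' e.symm) (fun e => hut e.symm) _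
      _ ≤ W := hb

end Literature.Probability.RandomPlanarGeometry.SAW.Zd.LoopErasure

end
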